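import Mathlib
import Literature.NumberTheory.LFunctions.MoebiusWalshCircuitsACdProofs
import Summits.QuantumAdvantage.QuantumAdvantage.Theorems.MobiusLadderLiouvilleNotTC0

/-!
# Crux `DigitPolyUniformity` (stmt-QuantumAdvantage-1392), line `Sketch` (LAR composition):
# shift-invariant digital phases correlate at most `1/3` with the Liouville function

Stub X9 of line Sketch/LAR of crux stmt-QuantumAdvantage-1392
(`Summit.QuantumAdvantage.QuantumAdvantage.Theses.MobiusLadder.DigitPolyUniformity`): the
UNCONDITIONAL constant-level bound that complete multiplicativity at the prime `2` gives for every
SHIFT-INVARIANT digital phase. If `P ∈ 𝔽₂[x_0, …, x_{n−1}]` satisfies `P(bits 2N) = P(bits N)`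
whenever `2N < 2ⁿ` (symmetric polynomials of any degree, digit-sum weights of any modulus,
zero-padded stationary forms of any window), then

  `3 · |Σ_{N<2ⁿ} λ(N) χ_P(N)| ≤ 2ⁿ + 1`,   `χ_P(N) = (−1)^{P(bits N)}`

(`liouville_corr_le_of_shiftInvariant`).

Proof. Put `a(N) = λ(N) χ_P(N)`; then `|a| ≤ 1` and `a(2N) = −a(N)` for `2N < 2ⁿ`
(`λ(2N) = −λ(N)`, the tree's `Literature.NumberTheory.LFunctions.Green2012.liouville_two_mul`, from
Mathlib `ArithmeticFunction.liouville_apply_mul`; in particular `a(0) = 0`).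
For ANY such `a` (`ShiftInvariant.three_mul_abs_sum_le`): with `S_k = Σ_{N<2^k} a(N)`, splitting by
parity gives `S_{k+1} = −S_k + Σ_{M<2^k} a(2M+1)` (`k + 1 ≤ n`), hence
`S_{k+2} − S_k = Σ_{2^k ≤ M < 2^{k+1}} a(2M+1)`, of modulus `≤ 2^k`; so
`3|S_{k+2}| ≤ 3|S_k| + 3·2^k ≤ (2^k + 1) + 3·2^k = 2^{k+2} + 1` by induction from `S_0 = a(0) = 0`
and `|S_1| = |a(1)| ≤ 1`.

Pure finite sums; no named facts. Reused from the tree: `liouville_two_mul` (above),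
`abs_cast_liouville_le_one` (`|λ| ≤ 1`) and `sum_range_two_mul` (parity split of `Σ_{N<2m}`) of
`Summit.QuantumAdvantage.QuantumAdvantage.Theorems.MobiusLadder` (`Theorems/MobiusLadderLiouvilleNotTC0`).
-/

namespace Summit.QuantumAdvantage.DigitPolyUniformity.SketchLAR

open Filter Finset
open Literature.NumberTheory.LFunctions.Green2012 (liouville_two_mul)
open Summit.QuantumAdvantage.QuantumAdvantage.Theorems.MobiusLadder (abs_cast_liouville_le_one
  sum_range_two_mul)

namespace ShiftInvariant

/-- **One parity split.** If `a(2N) = −a(N)` whenever `2N < 2ⁿ`, then for `k + 1 ≤ n`,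
`Σ_{N<2^{k+1}} a(N) = −Σ_{N<2^k} a(N) + Σ_{N<2^k} a(2N+1)`. [folklore] -/
theorem sum_range_pow_succ (a : ℕ → ℝ) {n k : ℕ} (hk : k + 1 ≤ n)
    (hdouble : ∀ N : ℕ, 2 * N < 2 ^ n → a (2 * N) = -a N) :
    ∑ N ∈ range (2 ^ (k + 1)), a N =
      -∑ N ∈ range (2 ^ k), a N + ∑ N ∈ range (2 ^ k), a (2 * N + 1) := by
  rw [pow_succ', sum_range_two_mul, sum_add_distrib, ← sum_neg_distrib]
  congr 1
  refine sum_congr rfl fun N hN => hdouble N ?_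
  rw [mem_range] at hN
  calc 2 * N < 2 * 2 ^ k := by omega
    _ = 2 ^ (k + 1) := (pow_succ' 2 k).symm
    _ ≤ 2 ^ n := Nat.pow_le_pow_right (by norm_num) hk

/-- **Two parity splits.** If `a(2N) = −a(N)` whenever `2N < 2ⁿ`, then for `k + 2 ≤ n`,
`Σ_{N<2^{k+2}} a(N) − Σ_{N<2^k} a(N) = Σ_{2^k ≤ M < 2^{k+1}} a(2M+1)`. [folklore] -/
theorem sum_range_pow_add_two_sub (a : ℕ → ℝ) {n k : ℕ} (hk : k + 2 ≤ n)
    (hdouble : ∀ N : ℕ, 2 * N < 2 ^ n → a (2 * N) = -a N) :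
    ∑ N ∈ range (2 ^ (k + 2)), a N - ∑ N ∈ range (2 ^ k), a N =
      ∑ M ∈ Ico (2 ^ k) (2 ^ (k + 1)), a (2 * M + 1) := by
  rw [sum_Ico_eq_sub _ (Nat.pow_le_pow_right (by norm_num) (Nat.le_succ k)),
    sum_range_pow_succ a hk hdouble, sum_range_pow_succ a (by omega : k + 1 ≤ n) hdouble]
  ring

/-- A sum of `2^{k+1} − 2^k = 2^k` terms of modulus `≤ 1` has modulus `≤ 2^k`. [folklore] -/
theorem abs_sum_Ico_le (b : ℕ → ℝ) (k : ℕ) (habs : ∀ N : ℕ, |b N| ≤ 1) :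
    |∑ M ∈ Ico (2 ^ k) (2 ^ (k + 1)), b M| ≤ (2 : ℝ) ^ k := by
  calc |∑ M ∈ Ico (2 ^ k) (2 ^ (k + 1)), b M|
      ≤ ∑ M ∈ Ico (2 ^ k) (2 ^ (k + 1)), |b M| := abs_sum_le_sum_abs _ _
    _ ≤ ∑ _M ∈ Ico (2 ^ k) (2 ^ (k + 1)), (1 : ℝ) := sum_le_sum fun M _ => habs M
    _ = (2 : ℝ) ^ k := by
        rw [sum_const, Nat.card_Ico, nsmul_eq_mul, mul_one,
          show 2 ^ (k + 1) - 2 ^ k = 2 ^ k by rw [pow_succ]; omega]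
        push_cast
        rfl

/-- **The `1/3` law for anti-doubling sequences.** If `|a| ≤ 1` and `a(2N) = −a(N)` whenever
`2N < 2ⁿ`, then `3·|Σ_{N<2^k} a(N)| ≤ 2^k + 1` for every `k ≤ n`: two-step induction on `k`
(`S_0 = a(0) = 0`, `|S_1| = |a(1)| ≤ 1`, `|S_{k+2}| ≤ |S_k| + 2^k`). [folklore] -/
theorem three_mul_abs_sum_le (a : ℕ → ℝ) (n : ℕ)
    (hdouble : ∀ N : ℕ, 2 * N < 2 ^ n → a (2 * N) = -a N) (habs : ∀ N : ℕ, |a N| ≤ 1) :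
    ∀ k : ℕ, k ≤ n → 3 * |∑ N ∈ range (2 ^ k), a N| ≤ (2 : ℝ) ^ k + 1 := by
  have ha0 : a 0 = 0 := by
    have h := hdouble 0 (by positivity)
    rw [mul_zero] at h
    linarith
  intro k
  induction k using Nat.twoStepInduction with
  | zero =>
    intro _
    norm_num [ha0]
  | one =>
    intro _
    have h1 := habs 1
    rw [pow_one, sum_range_succ, sum_range_one, ha0, zero_add, pow_one]
    linarith
  | more k ih _ =>
    intro hk
    have hrec := sum_range_pow_add_two_sub a hk hdouble
    have hR := abs_sum_Ico_le (fun M => a (2 * M + 1)) k fun N => habs _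
    have hS := ih (by omega)
    have htri := abs_sub_abs_le_abs_sub (∑ N ∈ range (2 ^ (k + 2)), a N)
      (∑ N ∈ range (2 ^ k), a N)
    rw [hrec] at htri
    have hpow : (2 : ℝ) ^ (k + 2) = 4 * 2 ^ k := by ring
    rw [hpow]
    linarith

end ShiftInvariant

/-- **Stub X9 (unconditional: shift-invariant phases correlate at most `1/3` with `λ`).** If
`P(bits 2N) = P(bits N)` whenever `2N < 2ⁿ` (the phase is invariant under the digit shift: symmetric
polynomials of ANY degree, digit-sum weights of ANY modulus, zero-padded stationary forms of ANY window),
then `3·|Σ_{N<2ⁿ} λ(N) χ_P(N)| ≤ 2ⁿ + 1`. Proof: with `a(N) = λ(N)χ_P(N)` one has `a(2N) = −a(N)`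
(`λ(2N) = −λ(N)`), so `S_k := Σ_{N<2^k} a` satisfies `S_k + S_{k−1} = Σ_{N<2^k, N odd} a`, hence
`S_k − S_{k−2} = Σ_{N odd ∈ [2^{k−1}, 2^k)} a`, of modulus `≤ 2^{k−2}` (`k ≥ 2`); telescoping from
`S_0 = 0`, `|S_1| ≤ 1` gives `|S_n| ≤ (2ⁿ + 1)/3` (`ShiftInvariant.three_mul_abs_sum_le`).
Constant-level and uniform over growing-parameter families (which are open at level `o(1)`); the `o(1)`
statement is the real content of the crux. [folklore] -/
theorem liouville_corr_le_of_shiftInvariant {n : ℕ} (P : MvPolynomial (Fin n) (ZMod 2))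
    (hP : ∀ N : ℕ, 2 * N < 2 ^ n →
      MvPolynomial.eval (fun i : Fin n => if Nat.testBit (2 * N) i then (1 : ZMod 2) else 0) P =
        MvPolynomial.eval (fun i : Fin n => if Nat.testBit N i then (1 : ZMod 2) else 0) P) :
    3 * |∑ N ∈ Finset.range (2 ^ n), ((ArithmeticFunction.liouville N : ℤ) : ℝ) *
        (if MvPolynomial.eval (fun i : Fin n => if Nat.testBit N i then (1 : ZMod 2) else 0) P = 1
          then (-1 : ℝ) else 1)| ≤ (2 : ℝ) ^ n + 1 := by
  refine ShiftInvariant.three_mul_abs_sum_le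
    (fun N => ((ArithmeticFunction.liouville N : ℤ) : ℝ) *
      (if MvPolynomial.eval (fun i : Fin n => if Nat.testBit N i then (1 : ZMod 2) else 0) P = 1
        then (-1 : ℝ) else 1)) n ?_ ?_ n le_rfl
  · intro N hN
    rw [hP N hN, liouville_two_mul, Int.cast_neg, neg_mul]
  · intro N
    rw [abs_mul]
    have h1 := abs_cast_liouville_le_one N
    have h2 : |(if MvPolynomial.eval (fun i : Fin n => if Nat.testBit N i then (1 : ZMod 2) else 0)
        P = 1 then (-1 : ℝ) else 1)| = 1 := by
      split_ifs <;> simp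
    rw [h2, mul_one]
    exact h1

end Summit.QuantumAdvantage.DigitPolyUniformity.SketchLAR
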